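import Literature.MathematicalPhysics.QuantumFieldTheory.Balaban1983to89.B9Eq376ProjPieceDirDictY

/-!
# `Balaban1983to89.B9Cor35PDirCubeNoLegHyp` — [Balaban1985BackgroundPropagators] (3.76)–(3.77) pp. 405–406 ∕ Cor. 3.5–3.6 for print's Dirichlet projection letter:
# FILES `B9Cor35PDirAtCubeField.cor35_PDir_cube`, `B9Cor35PDirWordIdentity.cor35_PCubeDY_cube`, `B9Eq376ProjPieceDirDictY.hPP_dirC_cube` RESTATED WITHOUT THE IDLE HYPOTHESIS «the knit cube legs at `Ṽ`
# are contractive» (it was threaded through but never used — the (3.19) letters `Q′_□`, `Q′*_□` enter Theorem 3.4's engines at `U = 1` only, where the legs are `1`)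
# (ROAD (I) U6f, hygiene; seat dag-n06-c g33)

statement-level skeleton of published theorems with citation tags; proofs where landed; nothing here is a claim about the Yang–Mills mass gap

## What this file does (mathematically)

Nothing new mathematically: the three theorems of FILES `B9Cor35PDirAtCubeField` ∕ `B9Cor35PDirWordIdentity` ∕ `B9Eq376ProjPieceDirDictY` are re-proved verbatim with one hypothesis fewer,
`∀ z w, ‖parKnitCubeY i □ Ṽ z w‖ ≤ 1 ∧ ‖(parKnitCubeY i □ Ṽ z w)⁻¹‖ ≤ 1`, which their proofs never consumed ([Balaban1985BackgroundPropagators] Thm 3.4 p. 400 takes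
the (3.19) letters at `U`, here `U = 1`, and the (3.57) differences `Q′(U′U) − Q′(U)` only through the (3.59) sizes).  Consumers should cite ★★★ `cor35_PDir_cube₀` ∕ `cor35_PCubeDY_cube₀` ∕ `hPP_dirC_cube₀`.

## Status

Printed-statement pass + proof body (proof-backed; assembly, copies of the landed proofs): [Balaban1985BackgroundPropagators] pp. 400–409, re-read 2026-08-31.
Honest label: hygiene restatement; the `A`-dependent (3.37)∕(3.59) data stay hypotheses.  Node N06 of the `pub-ymgap` DAG is NOT discharged here and the
Yang–Mills mass gap is NOT proved here.  NEW file; nothing landed is modified.  No `sorry`, no `axiom`, no `instance`, no `notation`.  Net new unproved facts: 0.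
Cell `pub-ymgap` (HUMAN RULING D-0062), node N06 [B9], seat `pub-ymgap-dag-n06-c` (g33), 2026-08-31.
RELATED, NOT DUPLICATED (searched 2026-08-31: `rg 'cor35_PDir_cube₀|cor35_PCubeDY_cube₀|hPP_dirC_cube₀'` = ∅): the three originals (one hypothesis more; kept, importers unaffected).
-/

noncomputable section

namespace Literature.MathematicalPhysics.QuantumFieldTheory.Balaban1983to89.B9Cor35PDirCubeNoLegHyp

open B6KLevelCensusIndexV1 (KIdx kGeo)
open B6Cover236MultiLevelBlocks (cubes)
open B6RandomWalk (HasMajorant BlockSupp hasMajorant_mono Triangle254 Ineq261 c1_nonneg)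
open B6RandomWalkHom (HasMajorantHom hasMajorantHom_mono)
open B9Thm34Ext (toB6)
open B9Ineq347 (ScaleTransfer)
open B9Eq352DivFormLetters (conj)
open B9Eq352GradLetters (diffLetter)
open B9Eq360Vprime (gPrimeExtEnd)
open B9Eq360VprimeLetters (vPrimeConc)
open B9Eq39Adjoint (covD covDstar)
open B9Eq352DivForm (tauB)
open B9Thm34InvBlk (thm34_Cinv_uniform_blk)
open B9CubeLettersOpsL0 (oddMh cubeFamY)
open B9CubeLettersBondOpsL0 (BlkCubeY qpKc qpsKc QpCubeY QpsCubeY)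
open B9Eq360DeltaPrimeAY (AfldY chartA)
open B9Eq360DeltaPrimeACubeY (blkCubeY kQCubeY sQCubeY kFCubeY sFCubeY)
open B9CubeGeometryInputs (geoCK geoCK_len geoCK_eta geoCK_eta_pos geoCK_len_pos geoCK_eta_le_len geoCK_dist_axioms stencil_geoCK geoCK_site_nonempty hST_geoCK
  exists_h261_geoCK N1 RM1)
open B9Cor35GpCubeInputsAtOne (wK cfunK wK_nonneg card_block_mul_wK_le norm_kQCubeY_one_le norm_sQCubeY_one_le abs_cfunK_le)
open B9Cor35GpDirInputsAtOne (dirDomY GpDirK)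
open B9Cor35GpDirAtCubeLetters (cor35_GpDir_cube)
open B9Cor35CinvAtCubeLetters (kernel_rate_mono)
open B9Cor36GpDirExtAtField (GextDirK_eq_GpDirVK)
open B9Eq337CutFieldDirY (cutFldS cutCfgS)
open B9Eq360PadDeltaCubeYAgree (compr_sub_compr_eq_cutCfgS)
open B9CubeSequence408Mirrors (mem_dirDomC_of_lev_pos)
open B9Cor35CDirCarrierAtOne (SBlk QcR QcsR CinvR hLinv_CinvR thm32_CinvR)
open B9Cor35CDirCarrierQLetters (hasMajorantHom_QcR hasMajorantHom_QcsR FcR FcsR QcR_eq_add QcsR_eq_add hasMajorantHom_FcR hasMajorantHom_FcsR)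
open B9Cor35CDirPaddedCarrier (eq_CinvR_of_laws)
open B9Cor35CDirWordAtField (word_at)
open Node00 (SiteY CfgY toKT shiftY)
open Node00.OpsYLocalInverse (dirPadY)
open Node00.OpsYCubeDirInverse (GpDirY padDeltaCubeY)
open Node00.OpsYCubeDirInverseBond (indProjY)
open Node00.OpsYCubeKnitPar (parKnitCubeY parKnitCubeY_one)
open Node00.OpsYCubeProjectionG (XCubeGY)

open B6RandomWalkSection (secExt secRes secConj)
open B6Geom246MultiLevelBoxL0 (blkOf corner corner_mem)
open B9Eq360Vprime (pPrime pOp)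
open B9Eq39Adjoint (prodCfg fluct)
open B9Eq376POneLetters (conjHom gradLin divLin)
open B9Thm34POneUniformBlk (exists_threshold_pOne_uniform_blk)
open B9Eq360DeltaPrimeAY (mulY UboxY_mulY_fluct)
open B9Cor35POneAtCubeLetters (pOp_sec_eq four_words_eq blkCubeY_corner)
open B9Cor36CutoffField337 (UboxY_one)
open B9Cor35GpDirInputsAtOne (isUnit_padDeltaCubeY_one_dirDomY)
open B9Cor35GCubeInputsAtOne (blkBK DK)
open B9Eq375GradDivSplitY (P0Y P1Y)
open B9Cor35PDirAtCubeField (rep_cornerS_injective prodCfg_one_chartA_eq_UboxY_cutCfgS)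
open B9Cor35PDirWordIdentity (pword_eq)
open B9Eq376ProjPieceDirDictY (hasMajorant_projWordDir_of_PDir)
open Node00 (UboxY gradY divY)
open Node00.OpsYCubeProjectionG (PCubeDY)

variable {d ℓ : ℕ} {hd : 1 ≤ d + 1} {hL : Odd (ℓ + 1) ∧ 1 < ℓ + 1} {b₀ b₁ : ℝ}
variable {𝔸 : Type} [NormedRing 𝔸] [NormedAlgebra ℂ 𝔸] [CompleteSpace 𝔸]
variable {ι : Type} [Fintype ι] (b : Module.Basis ι ℝ 𝔸)

set_option maxRecDepth 16384 in
/-- ★★★ **(3.76)–(3.77) ∕ COR. 3.5–3.6 FOR PRINT's DIRICHLET PROJECTION WORD ON THE CARRIER `𝔖 × ι` AT THE SMALL FIELD OF A CUT POTENTIAL, UNIFORMLY IN THE MEMBER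
AND THE COVER CUBE** — FILE `B9Cor35PDirAtCubeField.cor35_PDir_cube` WITHOUT the idle knit-leg contractivity hypothesis.
[cite: Balaban1985BackgroundPropagators, (3.76)–(3.77) pp.405–406, (3.68) p.403, (3.25) p.394, Cor. 3.5 p.407, Cor. 3.6 p.408, Thm 3.4 p.400, Thm 3.2 (3.48) p.398, p.409 l.1–5; Balaban1984PropagatorsII, Lemma 2.1 p.234, (2.51)–(2.52) p.232] -/
theorem cor35_PDir_cube₀ [DecidableEq ι] (d ℓ : ℕ) (hℓ : 1 ≤ ℓ) (Cq M₂ : ℝ) (hCq : 0 ≤ Cq) (hM₂ : 0 ≤ M₂) (hrepr : ∀ (v : 𝔸) (j : ι), |b.repr v j| ≤ M₂ * ‖v‖)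
    (h1 : ‖(1 : 𝔸)‖ ≤ 1) :
    ∃ δ M₀ T₀ : ℝ, ∃ N₀ : ℕ, 0 < δ ∧ ∃ a₁ : ℝ, 0 < a₁ ∧ ∃ K : ℝ, 0 ≤ K ∧
    ∀ {hd : 1 ≤ d + 1} {hL : Odd (ℓ + 1) ∧ 1 < ℓ + 1} {b₀ b₁ : ℝ} (i : KIdx d ℓ hd hL b₀ b₁) (c : ↥(cubes (toKT i).D.toDomains)) (Rr : ℝ) (H : Prop),
      M₀ ≤ ((ℓ : ℝ) + 1) * (toKT i).Mh → N₀ + 1 ≤ (toKT i).R * ((ℓ + 1) * (toKT i).Mh) → T₀ ≤ RM1 i →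
    ∀ (α₁ : ℝ), 0 ≤ α₁ → α₁ ≤ a₁ →
    ∀ (A : AfldY 𝔸 i),
      (∀ y x, blkCubeY i c x = y →
        ‖kFCubeY i c (parKnitCubeY i c) (fun _ _ => 1) (cutCfgS i (dirDomY i c) (kGeo i).eta A) y x‖ ≤ Cq * α₁ * wK i c y) →
      (∀ x, ‖sFCubeY i c (parKnitCubeY i c) (fun _ _ => 1) (cutCfgS i (dirDomY i c) (kGeo i).eta A) x‖ ≤ Cq * α₁) →
      (∀ ν k x, ‖(((geoCK i c).eta : ℂ)⁻¹) • covDstar (shiftY i) (fun _ _ => (1 : 𝔸ˣ)) ν (chartA i (cutFldS i (dirDomY i c) A) k) x‖ ≤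
        α₁ * ((geoCK i c).len (blkCubeY i c x) ^ 2)⁻¹) →
      (∀ μ ν x, ‖(((geoCK i c).eta : ℂ)⁻¹) • covD (shiftY i) (fun _ _ => (1 : 𝔸ˣ)) μ (chartA i (cutFldS i (dirDomY i c) A) ν) x‖ ≤
        α₁ * ((geoCK i c).len (blkCubeY i c x) ^ 2)⁻¹) →
      (∀ μ x, ‖(((geoCK i c).eta : ℂ)⁻¹) • covDstar (shiftY i) (fun _ _ => (1 : 𝔸ˣ)) μ
          (tauB (shiftY i) (fun _ _ => (1 : 𝔸ˣ)) μ (chartA i (cutFldS i (dirDomY i c) A) μ)) x‖ ≤ α₁ * ((geoCK i c).len (blkCubeY i c x) ^ 2)⁻¹) →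
      (∀ k x, ‖chartA i (cutFldS i (dirDomY i c) A) k x‖ ≤ α₁ * ((geoCK i c).len (blkCubeY i c x))⁻¹) →
      (∀ ν k x, ‖tauB (shiftY i) (fun _ _ => (1 : 𝔸ˣ)) ν (chartA i (cutFldS i (dirDomY i c) A) k) x‖ ≤ α₁ * ((geoCK i c).len (blkCubeY i c x))⁻¹) →
      (∀ (s : BlkCubeY i c) (lam : SiteY i → 𝔸),
        ‖(QpCubeY i c (parKnitCubeY i c) (cutCfgS i (dirDomY i c) (kGeo i).eta A) lam - QpCubeY i c (parKnitCubeY i c) (fun _ _ => 1) lam) s‖ ≤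
          Cq * α₁ * ∑ z, |qpKc i c s z| * ‖lam z‖) →
      (∀ (z : SiteY i) (nu : BlkCubeY i c → 𝔸),
        ‖(QpsCubeY i c (parKnitCubeY i c) (cutCfgS i (dirDomY i c) (kGeo i).eta A) nu - QpsCubeY i c (parKnitCubeY i c) (fun _ _ => 1) nu) z‖ ≤
          Cq * α₁ * ∑ s, |qpsKc i c z s| * ‖nu s‖) →
      HasMajorant (g := toB6 (geoCK i c) Rr H) (fun q : (Fin (d + 1) × SiteY i) × ι => blkCubeY i c q.1.2)
        (conjHom b (gradLin (shiftY i) (((geoCK i c).eta : ℂ)⁻¹) (UboxY i (cutCfgS i (dirDomY i c) (kGeo i).eta A))) ∘ₗ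
            (conj b (((kGeo i).eta ^ 2) • (Ring.inverse (padDeltaCubeY i c (parKnitCubeY i c) (dirDomY i c) (cutCfgS i (dirDomY i c) (kGeo i).eta A))).restrictScalars ℝ) ∘ₗ
              QcsR b i c (cutCfgS i (dirDomY i c) (kGeo i).eta A) ∘ₗ CinvR b i c (cutCfgS i (dirDomY i c) (kGeo i).eta A) ∘ₗ
              QcR b i c (cutCfgS i (dirDomY i c) (kGeo i).eta A) ∘ₗ
              conj b (((kGeo i).eta ^ 2) • (Ring.inverse (padDeltaCubeY i c (parKnitCubeY i c) (dirDomY i c) (cutCfgS i (dirDomY i c) (kGeo i).eta A))).restrictScalars ℝ)) ∘ₗ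
            conjHom b (divLin (shiftY i) (((geoCK i c).eta : ℂ)⁻¹) (UboxY i (cutCfgS i (dirDomY i c) (kGeo i).eta A))) -
          conjHom b (gradLin (shiftY i) (((geoCK i c).eta : ℂ)⁻¹) (fun _ _ => (1 : 𝔸ˣ))) ∘ₗ
            (GpDirK b i c (parKnitCubeY i c) ∘ₗ QcsR b i c (fun _ _ => 1) ∘ₗ CinvR b i c (fun _ _ => 1) ∘ₗ QcR b i c (fun _ _ => 1) ∘ₗ
              GpDirK b i c (parKnitCubeY i c)) ∘ₗ
            conjHom b (divLin (shiftY i) (((geoCK i c).eta : ℂ)⁻¹) (fun _ _ => (1 : 𝔸ˣ))))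
        (fun a a' => K * α₁ * ((geoCK i c).len a ^ 2)⁻¹ * Real.exp (-(δ * (geoCK i c).dist a a'))) := by
  classical
  have hSb : 0 ≤ ∑ j, ‖b j‖ := Finset.sum_nonneg fun j _ => norm_nonneg _
  -- UNIT 2: Theorem 3.1 for `GpDirK` (all orientations) and the word laws; U6b-i: Theorem 3.2 for `CinvR 1`
  obtain ⟨δG, BG, MG, TG, NG, hδG, hBG, aG, haG, BB, -, hG⟩ := cor35_GpDir_cube b d ℓ hℓ Cq M₂ hCq hM₂ hrepr h1
  obtain ⟨δ₂, C₂, M₂', hδ₂, hC₂, -, h32⟩ := thm32_CinvR b d ℓ hℓ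
  set δ₀ : ℝ := min δG δ₂ with hδ₀def
  have hδ₀ : 0 < δ₀ := lt_min hδG hδ₂
  have hδ₀1 : δ₀ ≤ δG := min_le_left _ _
  have hδ₀2 : δ₀ ≤ δ₂ := min_le_right _ _
  obtain ⟨dB, h261⟩ := exists_h261_geoCK d ℓ hδ₀
  have hΛf : ∀ α : ℝ, 0 < α → (1 : ℝ) ≤ ((ℓ : ℝ) + 1) ^ 4 := fun α _ =>
    one_le_pow₀ (by linarith [(Nat.cast_nonneg ℓ : (0 : ℝ) ≤ ℓ)])
  set κQ : ℝ := M₂ * (∑ j, ‖b j‖) + 1 with hκQdef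
  have hκQ : 0 < κQ := by rw [hκQdef]; nlinarith
  set cF : ℝ := M₂ * (∑ j, ‖b j‖) * Cq + 1 with hcFdef
  have hcF : 0 < cF := by rw [hcFdef]; nlinarith [mul_nonneg (mul_nonneg hM₂ hSb) hCq]
  obtain ⟨aP, haP, K, hK, H34⟩ := exists_threshold_pOne_uniform_blk b (Fin (d + 1)) dB δ₀ κQ BG C₂ cF Cq 1 1 M₂ (fun _ => ((ℓ : ℝ) + 1) ^ 4)
    hκQ hBG hC₂ hcF hCq zero_le_one hM₂ hδ₀ hΛf hrepr
  refine ⟨1 / 5 * δ₀, max M₂' MG, max (4 * Real.log ((ℓ : ℝ) + 1) / (9 / 5000 * δ₀)) TG, max (N1 d ℓ (9 / 5000 * δ₀)) NG, by positivity,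
    min aG aP, lt_min haG haP, K, hK, ?_⟩
  intro hd hL b₀ b₁ i c Rr H hM hN hT α₁ hα0 hα1 A hkF hsF h337B h337F h337Bτ hA hAτB hF hFs
  -- thresholds
  have hM2 : M₂' ≤ ((ℓ : ℝ) + 1) * (toKT i).Mh := (le_max_left _ _).trans hM
  have hMG : MG ≤ ((ℓ : ℝ) + 1) * (toKT i).Mh := (le_max_right _ _).trans hM
  have hN2 : N1 d ℓ (9 / 5000 * δ₀) + 1 ≤ (toKT i).R * ((ℓ + 1) * (toKT i).Mh) := le_trans (Nat.succ_le_succ (le_max_left _ _)) hN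
  have hNG : NG + 1 ≤ (toKT i).R * ((ℓ + 1) * (toKT i).Mh) := le_trans (Nat.succ_le_succ (le_max_right _ _)) hN
  have hT2 : 4 * Real.log ((ℓ : ℝ) + 1) / (9 / 5000 * δ₀) ≤ RM1 i := (le_max_left _ _).trans hT
  have hTG : TG ≤ RM1 i := (le_max_right _ _).trans hT
  -- UNIT 2 at the knit cube legs: (b), (c) and the word laws (d) at the cut potential; n06-a: the `G`-word is the padded inverse at `Ṽ`
  obtain ⟨-, e1, e2, e3, hrest⟩ := hG i c Rr H (parKnitCubeY i c) (parKnitCubeY_one i c) hMG hNG hTG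
  obtain ⟨hw1, hw2, -, -⟩ := hrest α₁ hα0 (hα1.trans (min_le_left _ _)) (chartA i (cutFldS i (dirDomY i c) A))
    (kFCubeY i c (parKnitCubeY i c) (fun _ _ => 1) (cutCfgS i (dirDomY i c) (kGeo i).eta A))
    (sFCubeY i c (parKnitCubeY i c) (fun _ _ => 1) (cutCfgS i (dirDomY i c) (kGeo i).eta A)) hkF hsF h337B h337F h337Bτ hA hAτB
  have hS1 : ∀ z : SiteY i, 1 ≤ B9CubeLettersOpsL0.levCubeY i c z → z ∈ dirDomY i c := fun z hz =>
    mem_dirDomC_of_lev_pos hL.1 (oddMh i) (toKT i).hMh (toKT i).hP c hz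
  obtain ⟨hunit, hGext⟩ := GextDirK_eq_GpDirVK b i c (parKnitCubeY i c) A (compr_sub_compr_eq_cutCfgS i c hS1 (kGeo i).eta A) hw1 hw2
  have hGw := hGext
  unfold B9Cor36GpDirExtAtField.GextDirK B9Cor36GpDirExtAtField.VpDirK B9Cor36GpDirExtAtField.GpDirVK at hGw
  -- geometry of the cube sequence (r05 FILE 5a)
  haveI : Nonempty (geoCK i c).Site := geoCK_site_nonempty i c
  obtain ⟨hdnn, htri, hrefl, hsym⟩ := geoCK_dist_axioms i c Rr H
  obtain ⟨hd₀B, hd₀F, hd₀0⟩ := stencil_geoCK i c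
  -- Theorem 3.1 (3.42)₁,₂,₃ for `GpDirK` at the rate `δ₀`
  have g342_1 : HasMajorant (g := toB6 (geoCK i c) Rr H) (fun p : SiteY i × ι => blkCubeY i c p.1) (GpDirK b i c (parKnitCubeY i c))
      (fun a a' => BG * (geoCK i c).len a ^ 2 * Real.exp (-(δ₀ * (geoCK i c).dist a a'))) :=
    hasMajorant_mono (g := toB6 (geoCK i c) Rr H) _ e1 fun a a' => kernel_rate_mono hdnn hδ₀1 (mul_nonneg hBG.le (sq_nonneg _)) a a'
  have g342_2 : ∀ k : Fin (d + 1) ⊕ Fin (d + 1), HasMajorant (g := toB6 (geoCK i c) Rr H) (fun p : SiteY i × ι => blkCubeY i c p.1)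
      (conj b (diffLetter (shiftY i) (fun _ _ => (1 : 𝔸ˣ)) ((((geoCK i c).eta : ℂ))⁻¹) k) * GpDirK b i c (parKnitCubeY i c))
      (fun a a' => BG * (geoCK i c).len a * Real.exp (-(δ₀ * (geoCK i c).dist a a'))) := fun k =>
    hasMajorant_mono (g := toB6 (geoCK i c) Rr H) _ (e2 k) fun a a' => kernel_rate_mono hdnn hδ₀1 (mul_nonneg hBG.le (geoCK_len_pos i c a).le) a a'
  have g342_3 : ∀ k : Fin (d + 1) ⊕ Fin (d + 1), HasMajorant (g := toB6 (geoCK i c) Rr H) (fun p : SiteY i × ι => blkCubeY i c p.1)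
      (GpDirK b i c (parKnitCubeY i c) * conj b (diffLetter (shiftY i) (fun _ _ => (1 : 𝔸ˣ)) ((((geoCK i c).eta : ℂ))⁻¹) k))
      (fun a a' => BG * (geoCK i c).len a * Real.exp (-(δ₀ * (geoCK i c).dist a a'))) := fun k =>
    hasMajorant_mono (g := toB6 (geoCK i c) Rr H) _ (e3 k) fun a a' => kernel_rate_mono hdnn hδ₀1 (mul_nonneg hBG.le (geoCK_len_pos i c a).le) a a'
  -- the (3.19) letters at `U = 1` on the carrier
  have hκle : M₂ * (∑ j, ‖b j‖) ≤ κQ := by rw [hκQdef]; linarith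
  have hpar1 : ∀ z w : SiteY i, ‖((parKnitCubeY i c (fun _ _ => 1) z w : 𝔸ˣ) : 𝔸)‖ ≤ 1 ∧
      ‖(((parKnitCubeY i c (fun _ _ => 1) z w)⁻¹ : 𝔸ˣ) : 𝔸)‖ ≤ 1 := fun z w => by
    rw [parKnitCubeY_one i c z w, inv_one, Units.val_one]; exact ⟨h1, h1⟩
  have hQc := hasMajorantHom_mono (g := toB6 (geoCK i c) Rr H) _ _
    (hasMajorantHom_QcR b i c (fun _ _ => 1) (Rr := Rr) (Hp := H) hpar1 hM₂ hrepr)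
    (K' := fun a a' : BlkCubeY i c => κQ * (if a = a' then (1 : ℝ) else 0)) fun a a' => by
      split_ifs
      · rw [mul_one]; exact hκle
      · rw [mul_zero]
  have hQcs := hasMajorantHom_mono (g := toB6 (geoCK i c) Rr H) _ _
    (hasMajorantHom_QcsR b i c (fun _ _ => 1) (Rr := Rr) (Hp := H) hpar1 hM₂ hrepr)
    (K' := fun a a' : BlkCubeY i c => κQ * (if a = a' then (1 : ℝ) else 0)) fun a a' => by
      split_ifs
      · rw [mul_one]; exact hκle
      · rw [mul_zero]
  -- Theorem 3.2 at `U = 1` on the carrier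
  have hLinv := hLinv_CinvR b i c
  have h348 : HasMajorant (g := toB6 (geoCK i c) Rr H) (fun q : ↥(SBlk i c) × ι => (q.1 : BlkCubeY i c)) (CinvR b i c (fun _ _ => 1))
      (fun a a' => C₂ * (geoCK i c).len a ^ (-(4 : ℝ)) * Real.exp (-(δ₀ * (geoCK i c).dist a a'))) :=
    hasMajorant_mono (g := toB6 (geoCK i c) Rr H) _ (h32 i c Rr H hM2)
      fun a a' => kernel_rate_mono hdnn hδ₀2 (mul_nonneg hC₂.le (Real.rpow_nonneg (geoCK_len_pos i c a).le _)) a a'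
  -- the (3.57) letters on the carrier
  have hcle : M₂ * (∑ j, ‖b j‖) * (Cq * α₁) ≤ cF * α₁ := by
    rw [hcFdef]; nlinarith [mul_nonneg (mul_nonneg hM₂ hSb) hCq]
  have hFc := hasMajorantHom_mono (g := toB6 (geoCK i c) Rr H) _ _
    (hasMajorantHom_FcR b i c (cutCfgS i (dirDomY i c) (kGeo i).eta A) (Rr := Rr) (Hp := H) hM₂ hrepr (by positivity) hF)
    (K' := fun a a' : BlkCubeY i c => cF * α₁ * (if a = a' then (1 : ℝ) else 0)) fun a a' => by
      split_ifs
      · rw [mul_one]; exact hcle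
      · rw [mul_zero]
  have hFcs := hasMajorantHom_mono (g := toB6 (geoCK i c) Rr H) _ _
    (hasMajorantHom_FcsR b i c (cutCfgS i (dirDomY i c) (kGeo i).eta A) (Rr := Rr) (Hp := H) hM₂ hrepr (by positivity) hFs)
    (K' := fun a a' : BlkCubeY i c => cF * α₁ * (if a = a' then (1 : ℝ) else 0)) fun a a' => by
      split_ifs
      · rw [mul_one]; exact hcle
      · rw [mul_zero]
  -- the corner section of the carrier
  have hrep : ∀ p : ↥(SBlk i c) × ι,
      blkCubeY i c ((fun p : ↥(SBlk i c) × ι =>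
        ((⟨corner (cubeFamY i c).toDomains p.1.1, corner_mem (cubeFamY i c).toDomains p.1.1⟩ : SiteY i), p.2)) p).1 = (p.1 : BlkCubeY i c) :=
    fun p => blkCubeY_corner i c p.1.1
  -- r06's `P₁`-clause on the Dirichlet carrier
  obtain ⟨Tinv, hT1, hT2, hTm⟩ := H34 (shiftY i) (fun _ _ => (1 : 𝔸ˣ)) (g := geoCK i c) (Rr := Rr) (H := H) (blkCubeY i c)
    (kQCubeY i c (parKnitCubeY i c) (fun _ _ => 1)) (sQCubeY i c (parKnitCubeY i c) (fun _ _ => 1)) (cfunK i c) (wK i c)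
    hdnn htri hrefl hsym (geoCK_len_pos i c) (geoCK_eta_le_len i c) (geoCK_eta_pos i c)
    (fun α hα hα1 => h261 i c Rr H hN2 α hα hα1.le) (hST_geoCK i c hδ₀ hT2)
    (fun _ _ => ⟨h1, by rw [inv_one, Units.val_one]; exact h1⟩) hd₀B hd₀F hd₀0 (wK_nonneg i c) (card_block_mul_wK_le i c)
    (fun y x hx => by rw [← hx]; exact norm_kQCubeY_one_le i c (parKnitCubeY i c) h1 (parKnitCubeY_one i c) _ x)
    (norm_sQCubeY_one_le i c (parKnitCubeY i c) h1 (parKnitCubeY_one i c)) (abs_cfunK_le i c)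
    g342_1 g342_2 g342_3 (fun q : ↥(SBlk i c) × ι => (q.1 : BlkCubeY i c)) _ hrep (rep_cornerS_injective i c) hQc hQcs hLinv h348
    α₁ hα0 (hα1.trans (min_le_right _ _)) (chartA i (cutFldS i (dirDomY i c) A))
    (kFCubeY i c (parKnitCubeY i c) (fun _ _ => 1) (cutCfgS i (dirDomY i c) (kGeo i).eta A))
    (sFCubeY i c (parKnitCubeY i c) (fun _ _ => 1) (cutCfgS i (dirDomY i c) (kGeo i).eta A))
    hkF hsF h337B h337F h337Bτ hA hAτB (QcR_eq_add b i c _) (QcsR_eq_add b i c _) hFc hFcs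
  -- identify the engine's inverse `Tinv` with `CinvR Ṽ` and the engine's `G`-word with the padded inverse at `Ṽ`
  rw [hGw, word_at b i c _ hunit] at hT1 hT2
  obtain ⟨-, hTinv⟩ := eq_CinvR_of_laws b i c _ hT1 hT2
  rw [hGw, hTinv, prodCfg_one_chartA_eq_UboxY_cutCfgS, pPrime, pOp_sec_eq (rep_cornerS_injective i c), pOp_sec_eq (rep_cornerS_injective i c),
    four_words_eq] at hTm
  exact hTm


set_option maxRecDepth 16384 in
/-- ★★★ **(3.76)–(3.77) ∕ COR. 3.5–3.6 FOR node00-def-Y's DIRICHLET PROJECTION LETTER `P_□ = PCubeDY i □ 𝔭 (GpDirY … Ω₀(□)) 𝔖` AT THE SMALL FIELD OF A CUT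
POTENTIAL**: the realified difference `∇_Ṽ ∘ conj b(P_□(Ṽ)) ∘ ∇*_Ṽ − ∇_1 ∘ conj b(P_□(1)) ∘ ∇*_1` has the block majorant `K·α₁·ℓ(a)⁻²·e^{−δd(a,a′)}` over
`(toB6 (geoCK i □) Rr H, q ↦ blkCubeY(q.1.2))`, uniformly in the member and the cover cube — FILE `B9Cor35PDirWordIdentity.cor35_PCubeDY_cube` WITHOUT the idle knit-leg contractivity hypothesis.
[cite: Balaban1985BackgroundPropagators, (3.76)–(3.77) pp.405–406, (3.25) p.394, Cor. 3.5 p.407, Cor. 3.6 p.408, p.409 l.1–5; Balaban1984PropagatorsII, Lemma 2.1 p.234, (2.51)–(2.52) p.232] -/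
theorem cor35_PCubeDY_cube₀ [DecidableEq ι] (d ℓ : ℕ) (hℓ : 1 ≤ ℓ) (Cq M₂ : ℝ) (hCq : 0 ≤ Cq) (hM₂ : 0 ≤ M₂) (hrepr : ∀ (v : 𝔸) (j : ι), |b.repr v j| ≤ M₂ * ‖v‖)
    (h1 : ‖(1 : 𝔸)‖ ≤ 1) :
    ∃ δ M₀ T₀ : ℝ, ∃ N₀ : ℕ, 0 < δ ∧ ∃ a₁ : ℝ, 0 < a₁ ∧ ∃ K : ℝ, 0 ≤ K ∧
    ∀ {hd : 1 ≤ d + 1} {hL : Odd (ℓ + 1) ∧ 1 < ℓ + 1} {b₀ b₁ : ℝ} (i : KIdx d ℓ hd hL b₀ b₁) (c : ↥(cubes (toKT i).D.toDomains)) (Rr : ℝ) (H : Prop),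
      M₀ ≤ ((ℓ : ℝ) + 1) * (toKT i).Mh → N₀ + 1 ≤ (toKT i).R * ((ℓ + 1) * (toKT i).Mh) → T₀ ≤ RM1 i →
    ∀ (α₁ : ℝ), 0 ≤ α₁ → α₁ ≤ a₁ →
    ∀ (A : AfldY 𝔸 i),
      (∀ y x, blkCubeY i c x = y →
        ‖kFCubeY i c (parKnitCubeY i c) (fun _ _ => 1) (cutCfgS i (dirDomY i c) (kGeo i).eta A) y x‖ ≤ Cq * α₁ * wK i c y) →
      (∀ x, ‖sFCubeY i c (parKnitCubeY i c) (fun _ _ => 1) (cutCfgS i (dirDomY i c) (kGeo i).eta A) x‖ ≤ Cq * α₁) →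
      (∀ ν k x, ‖(((geoCK i c).eta : ℂ)⁻¹) • covDstar (shiftY i) (fun _ _ => (1 : 𝔸ˣ)) ν (chartA i (cutFldS i (dirDomY i c) A) k) x‖ ≤
        α₁ * ((geoCK i c).len (blkCubeY i c x) ^ 2)⁻¹) →
      (∀ μ ν x, ‖(((geoCK i c).eta : ℂ)⁻¹) • covD (shiftY i) (fun _ _ => (1 : 𝔸ˣ)) μ (chartA i (cutFldS i (dirDomY i c) A) ν) x‖ ≤
        α₁ * ((geoCK i c).len (blkCubeY i c x) ^ 2)⁻¹) →
      (∀ μ x, ‖(((geoCK i c).eta : ℂ)⁻¹) • covDstar (shiftY i) (fun _ _ => (1 : 𝔸ˣ)) μ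
          (tauB (shiftY i) (fun _ _ => (1 : 𝔸ˣ)) μ (chartA i (cutFldS i (dirDomY i c) A) μ)) x‖ ≤ α₁ * ((geoCK i c).len (blkCubeY i c x) ^ 2)⁻¹) →
      (∀ k x, ‖chartA i (cutFldS i (dirDomY i c) A) k x‖ ≤ α₁ * ((geoCK i c).len (blkCubeY i c x))⁻¹) →
      (∀ ν k x, ‖tauB (shiftY i) (fun _ _ => (1 : 𝔸ˣ)) ν (chartA i (cutFldS i (dirDomY i c) A) k) x‖ ≤ α₁ * ((geoCK i c).len (blkCubeY i c x))⁻¹) →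
      (∀ (s : BlkCubeY i c) (lam : SiteY i → 𝔸),
        ‖(QpCubeY i c (parKnitCubeY i c) (cutCfgS i (dirDomY i c) (kGeo i).eta A) lam - QpCubeY i c (parKnitCubeY i c) (fun _ _ => 1) lam) s‖ ≤
          Cq * α₁ * ∑ z, |qpKc i c s z| * ‖lam z‖) →
      (∀ (z : SiteY i) (nu : BlkCubeY i c → 𝔸),
        ‖(QpsCubeY i c (parKnitCubeY i c) (cutCfgS i (dirDomY i c) (kGeo i).eta A) nu - QpsCubeY i c (parKnitCubeY i c) (fun _ _ => 1) nu) z‖ ≤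
          Cq * α₁ * ∑ s, |qpsKc i c z s| * ‖nu s‖) →
      HasMajorant (g := toB6 (geoCK i c) Rr H) (fun q : (Fin (d + 1) × SiteY i) × ι => blkCubeY i c q.1.2)
        (conjHom b (gradLin (shiftY i) (((geoCK i c).eta : ℂ)⁻¹) (UboxY i (cutCfgS i (dirDomY i c) (kGeo i).eta A))) ∘ₗ
            conj b ((PCubeDY i c (parKnitCubeY i c) (GpDirY i c (parKnitCubeY i c) (dirDomY i c)) (SBlk i c)
              (cutCfgS i (dirDomY i c) (kGeo i).eta A)).restrictScalars ℝ) ∘ₗ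
            conjHom b (divLin (shiftY i) (((geoCK i c).eta : ℂ)⁻¹) (UboxY i (cutCfgS i (dirDomY i c) (kGeo i).eta A))) -
          conjHom b (gradLin (shiftY i) (((geoCK i c).eta : ℂ)⁻¹) (fun _ _ => (1 : 𝔸ˣ))) ∘ₗ
            conj b ((PCubeDY i c (parKnitCubeY i c) (GpDirY i c (parKnitCubeY i c) (dirDomY i c)) (SBlk i c) (fun _ _ => 1)).restrictScalars ℝ) ∘ₗ
            conjHom b (divLin (shiftY i) (((geoCK i c).eta : ℂ)⁻¹) (fun _ _ => (1 : 𝔸ˣ))))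
        (fun a a' => K * α₁ * ((geoCK i c).len a ^ 2)⁻¹ * Real.exp (-(δ * (geoCK i c).dist a a'))) := by
  obtain ⟨δ, M₀, T₀, N₀, hδ, a₁, ha₁, K, hK, hP⟩ := cor35_PDir_cube₀ b d ℓ hℓ Cq M₂ hCq hM₂ hrepr h1
  -- the word laws of UNIT 2 (d) give the unit at `Ṽ` (n06-a); same thresholds suffice after enlarging
  obtain ⟨δG, BG, MG, TG, NG, -, -, aG, haG, BB, -, hG⟩ := cor35_GpDir_cube b d ℓ hℓ Cq M₂ hCq hM₂ hrepr h1
  refine ⟨δ, max M₀ MG, max T₀ TG, max N₀ NG, hδ, min a₁ aG, lt_min ha₁ haG, K, hK, ?_⟩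
  intro hd hL b₀ b₁ i c Rr H hM hN hT α₁ hα0 hα1 A hkF hsF h337B h337F h337Bτ hA hAτB hF hFs
  have hM0 : M₀ ≤ ((ℓ : ℝ) + 1) * (toKT i).Mh := (le_max_left _ _).trans hM
  have hMG : MG ≤ ((ℓ : ℝ) + 1) * (toKT i).Mh := (le_max_right _ _).trans hM
  have hN0 : N₀ + 1 ≤ (toKT i).R * ((ℓ + 1) * (toKT i).Mh) := le_trans (Nat.succ_le_succ (le_max_left _ _)) hN
  have hNG : NG + 1 ≤ (toKT i).R * ((ℓ + 1) * (toKT i).Mh) := le_trans (Nat.succ_le_succ (le_max_right _ _)) hN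
  have hT0 : T₀ ≤ RM1 i := (le_max_left _ _).trans hT
  have hTG : TG ≤ RM1 i := (le_max_right _ _).trans hT
  obtain ⟨-, -, -, -, hrest⟩ := hG i c Rr H (parKnitCubeY i c) (parKnitCubeY_one i c) hMG hNG hTG
  obtain ⟨hw1, hw2, -, -⟩ := hrest α₁ hα0 (hα1.trans (min_le_right _ _)) (chartA i (cutFldS i (dirDomY i c) A))
    (kFCubeY i c (parKnitCubeY i c) (fun _ _ => 1) (cutCfgS i (dirDomY i c) (kGeo i).eta A))
    (sFCubeY i c (parKnitCubeY i c) (fun _ _ => 1) (cutCfgS i (dirDomY i c) (kGeo i).eta A)) hkF hsF h337B h337F h337Bτ hA hAτB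
  have hS1 : ∀ z : SiteY i, 1 ≤ B9CubeLettersOpsL0.levCubeY i c z → z ∈ dirDomY i c := fun z hz =>
    mem_dirDomC_of_lev_pos hL.1 (oddMh i) (toKT i).hMh (toKT i).hP c hz
  obtain ⟨hunitV, -⟩ := GextDirK_eq_GpDirVK b i c (parKnitCubeY i c) A (compr_sub_compr_eq_cutCfgS i c hS1 (kGeo i).eta A) hw1 hw2
  have hunit1 : IsUnit (padDeltaCubeY i c (parKnitCubeY i c) (dirDomY i c) (fun _ _ => (1 : 𝔸ˣ))) :=
    isUnit_padDeltaCubeY_one_dirDomY i c (parKnitCubeY i c) (parKnitCubeY_one i c)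
  have hm := hP i c Rr H hM0 hN0 hT0 α₁ hα0 (hα1.trans (min_le_left _ _)) A hkF hsF h337B h337F h337Bτ hA hAτB hF hFs
  have hGp1 : GpDirK b i c (parKnitCubeY i c) =
      conj b (((kGeo i).eta ^ 2) • (Ring.inverse (padDeltaCubeY i c (parKnitCubeY i c) (dirDomY i c) (fun _ _ => (1 : 𝔸ˣ)))).restrictScalars ℝ) := rfl
  rw [hGp1] at hm
  simp only [LinearMap.comp_assoc] at hm
  rw [show conj b (((kGeo i).eta ^ 2) • (Ring.inverse (padDeltaCubeY i c (parKnitCubeY i c) (dirDomY i c)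
        (cutCfgS i (dirDomY i c) (kGeo i).eta A))).restrictScalars ℝ) ∘ₗ QcsR b i c (cutCfgS i (dirDomY i c) (kGeo i).eta A) ∘ₗ
        CinvR b i c (cutCfgS i (dirDomY i c) (kGeo i).eta A) ∘ₗ QcR b i c (cutCfgS i (dirDomY i c) (kGeo i).eta A) ∘ₗ
        conj b (((kGeo i).eta ^ 2) • (Ring.inverse (padDeltaCubeY i c (parKnitCubeY i c) (dirDomY i c)
          (cutCfgS i (dirDomY i c) (kGeo i).eta A))).restrictScalars ℝ) ∘ₗ
        conjHom b (divLin (shiftY i) (((geoCK i c).eta : ℂ)⁻¹) (UboxY i (cutCfgS i (dirDomY i c) (kGeo i).eta A))) =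
      conj b ((PCubeDY i c (parKnitCubeY i c) (GpDirY i c (parKnitCubeY i c) (dirDomY i c)) (SBlk i c)
        (cutCfgS i (dirDomY i c) (kGeo i).eta A)).restrictScalars ℝ) ∘ₗ
        conjHom b (divLin (shiftY i) (((geoCK i c).eta : ℂ)⁻¹) (UboxY i (cutCfgS i (dirDomY i c) (kGeo i).eta A))) by
      rw [← pword_eq b i c _ hunitV]; simp only [LinearMap.comp_assoc],
    show conj b (((kGeo i).eta ^ 2) • (Ring.inverse (padDeltaCubeY i c (parKnitCubeY i c) (dirDomY i c) (fun _ _ => (1 : 𝔸ˣ)))).restrictScalars ℝ) ∘ₗ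
        QcsR b i c (fun _ _ => 1) ∘ₗ CinvR b i c (fun _ _ => 1) ∘ₗ QcR b i c (fun _ _ => 1) ∘ₗ
        conj b (((kGeo i).eta ^ 2) • (Ring.inverse (padDeltaCubeY i c (parKnitCubeY i c) (dirDomY i c) (fun _ _ => (1 : 𝔸ˣ)))).restrictScalars ℝ) ∘ₗ
        conjHom b (divLin (shiftY i) (((geoCK i c).eta : ℂ)⁻¹) (fun _ _ => (1 : 𝔸ˣ))) =
      conj b ((PCubeDY i c (parKnitCubeY i c) (GpDirY i c (parKnitCubeY i c) (dirDomY i c)) (SBlk i c) (fun _ _ => 1)).restrictScalars ℝ) ∘ₗ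
        conjHom b (divLin (shiftY i) (((geoCK i c).eta : ℂ)⁻¹) (fun _ _ => (1 : 𝔸ˣ))) by
      rw [← pword_eq b i c _ hunit1]; simp only [LinearMap.comp_assoc]] at hm
  simpa only [LinearMap.comp_assoc] using hm


set_option maxRecDepth 16384 in
/-- ★★★ **(3.77) FOR THE DIRICHLET PROJECTION PIECE IN def-Y's BOND LETTERS**: constants `δ > 0`, thresholds, `a₁ > 0`, `K ≥ 0` (functions of `d, L, M₂, C_q`) such that
for every member above threshold, cover cube, `0 ≤ α₁ ≤ a₁` and vector potential `A` with the (3.37)∕(3.59) data of FILE `B9Cor35CDirAtCubeField` at the cut potential,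
`conj b((D_Ṽ𝒫_□(Ṽ)D*_Ṽ − D₁𝒫_□(1)D*₁)^ℝ) ≺ K·α₁·ℓ(a)⁻²·e^{−δd}` over `(toB6 (geoCK i □) Rr H, blkBK i □)`, `Ṽ = cutCfgS Ω₀(□) η A` — FILE `B9Eq376ProjPieceDirDictY.hPP_dirC_cube` WITHOUT the idle knit-leg contractivity hypothesis; the `hPP` binder of
`B9Cor35GDirAtCubeLetters.cor35_GDir_of_pieces` at `S = Ω₀(□)`. [cite: Balaban1985BackgroundPropagators, (3.76)–(3.77) pp.405–406, (3.82) p.407, Cor. 3.5 p.407, Cor. 3.6 p.408, p.409 l.1–5; Balaban1984PropagatorsII, Lemma 2.1 p.234, (2.51) p.232] -/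
theorem hPP_dirC_cube₀ [DecidableEq ι] (d ℓ : ℕ) (hℓ : 1 ≤ ℓ) (Cq M₂ : ℝ) (hCq : 0 ≤ Cq) (hM₂ : 0 ≤ M₂) (hrepr : ∀ (v : 𝔸) (j : ι), |b.repr v j| ≤ M₂ * ‖v‖)
    (h1 : ‖(1 : 𝔸)‖ ≤ 1) :
    ∃ δ M₀ T₀ : ℝ, ∃ N₀ : ℕ, 0 < δ ∧ ∃ a₁ : ℝ, 0 < a₁ ∧ ∃ K : ℝ, 0 ≤ K ∧
    ∀ {hd : 1 ≤ d + 1} {hL : Odd (ℓ + 1) ∧ 1 < ℓ + 1} {b₀ b₁ : ℝ} (i : KIdx d ℓ hd hL b₀ b₁) (c : ↥(cubes (toKT i).D.toDomains)) (Rr : ℝ) (H : Prop),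
      M₀ ≤ ((ℓ : ℝ) + 1) * (toKT i).Mh → N₀ + 1 ≤ (toKT i).R * ((ℓ + 1) * (toKT i).Mh) → T₀ ≤ RM1 i →
    ∀ (α₁ : ℝ), 0 ≤ α₁ → α₁ ≤ a₁ →
    ∀ (A : AfldY 𝔸 i),
      (∀ y x, blkCubeY i c x = y →
        ‖kFCubeY i c (parKnitCubeY i c) (fun _ _ => 1) (cutCfgS i (dirDomY i c) (kGeo i).eta A) y x‖ ≤ Cq * α₁ * wK i c y) →
      (∀ x, ‖sFCubeY i c (parKnitCubeY i c) (fun _ _ => 1) (cutCfgS i (dirDomY i c) (kGeo i).eta A) x‖ ≤ Cq * α₁) →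
      (∀ ν k x, ‖(((geoCK i c).eta : ℂ)⁻¹) • covDstar (shiftY i) (fun _ _ => (1 : 𝔸ˣ)) ν (chartA i (cutFldS i (dirDomY i c) A) k) x‖ ≤
        α₁ * ((geoCK i c).len (blkCubeY i c x) ^ 2)⁻¹) →
      (∀ μ ν x, ‖(((geoCK i c).eta : ℂ)⁻¹) • covD (shiftY i) (fun _ _ => (1 : 𝔸ˣ)) μ (chartA i (cutFldS i (dirDomY i c) A) ν) x‖ ≤
        α₁ * ((geoCK i c).len (blkCubeY i c x) ^ 2)⁻¹) →
      (∀ μ x, ‖(((geoCK i c).eta : ℂ)⁻¹) • covDstar (shiftY i) (fun _ _ => (1 : 𝔸ˣ)) μ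
          (tauB (shiftY i) (fun _ _ => (1 : 𝔸ˣ)) μ (chartA i (cutFldS i (dirDomY i c) A) μ)) x‖ ≤ α₁ * ((geoCK i c).len (blkCubeY i c x) ^ 2)⁻¹) →
      (∀ k x, ‖chartA i (cutFldS i (dirDomY i c) A) k x‖ ≤ α₁ * ((geoCK i c).len (blkCubeY i c x))⁻¹) →
      (∀ ν k x, ‖tauB (shiftY i) (fun _ _ => (1 : 𝔸ˣ)) ν (chartA i (cutFldS i (dirDomY i c) A) k) x‖ ≤ α₁ * ((geoCK i c).len (blkCubeY i c x))⁻¹) →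
      (∀ (s : BlkCubeY i c) (lam : SiteY i → 𝔸),
        ‖(QpCubeY i c (parKnitCubeY i c) (cutCfgS i (dirDomY i c) (kGeo i).eta A) lam - QpCubeY i c (parKnitCubeY i c) (fun _ _ => 1) lam) s‖ ≤
          Cq * α₁ * ∑ z, |qpKc i c s z| * ‖lam z‖) →
      (∀ (z : SiteY i) (nu : BlkCubeY i c → 𝔸),
        ‖(QpsCubeY i c (parKnitCubeY i c) (cutCfgS i (dirDomY i c) (kGeo i).eta A) nu - QpsCubeY i c (parKnitCubeY i c) (fun _ _ => 1) nu) z‖ ≤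
          Cq * α₁ * ∑ s, |qpsKc i c z s| * ‖nu s‖) →
      HasMajorant (g := toB6 (geoCK i c) Rr H) (blkBK i c)
        (conj b ((gradY i (cutCfgS i (dirDomY i c) (kGeo i).eta A) ∘ₗ
            PCubeDY i c (parKnitCubeY i c) (GpDirY i c (parKnitCubeY i c) (dirDomY i c)) (SBlk i c) (cutCfgS i (dirDomY i c) (kGeo i).eta A) ∘ₗ
            divY i (cutCfgS i (dirDomY i c) (kGeo i).eta A) -
          gradY i (fun _ _ => 1) ∘ₗ PCubeDY i c (parKnitCubeY i c) (GpDirY i c (parKnitCubeY i c) (dirDomY i c)) (SBlk i c) (fun _ _ => 1) ∘ₗ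
            divY i (fun _ _ => 1)).restrictScalars ℝ))
        (fun a a' => K * α₁ * ((geoCK i c).len a ^ 2)⁻¹ * Real.exp (-(δ * (geoCK i c).dist a a'))) := by
  obtain ⟨δ, M₀, T₀, N₀, hδ, a₁, ha₁, K, hK, hP⟩ := cor35_PCubeDY_cube₀ b d ℓ hℓ Cq M₂ hCq hM₂ hrepr h1
  refine ⟨δ, M₀, T₀, N₀, hδ, a₁, ha₁, K, hK, ?_⟩
  intro hd hL b₀ b₁ i c Rr H hM hN hT α₁ hα0 hα1 A hkF hsF h337B h337F h337Bτ hA hAτB hF hFs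
  exact hasMajorant_projWordDir_of_PDir b i c Rr H _
    (hP i c Rr H hM hN hT α₁ hα0 hα1 A hkF hsF h337B h337F h337Bτ hA hAτB hF hFs)


end Literature.MathematicalPhysics.QuantumFieldTheory.Balaban1983to89.B9Cor35PDirCubeNoLegHyp
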